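import Summits.RiemannHypothesis.RiemannHypothesis.Theorems.NymanBeurlingVasyunin
import HarnessLib

/-!
# RiemannHypothesis / Nyman–Beurling — the `3 × 3` Gram block in radicals: `G_{13}`, `G_{23}` from Vasyunin's formula (RH-FREE)

Column LI/NB of the RH ladder, rung L-P(P2), PROOF-OF-DATA for cell `pub/rh-li` [rh-li-eng-3 g4].  With `bbls2003_prop89_holds`
(`NymanBeurlingVasyunin.lean`) the Gram matrix is in closed form for every entry; here the two new entries of the `3 × 3` block are
evaluated in radicals (the cotangent sums at `q = 3`: `V(1,3) = −√3/9`, `V(2,3) = √3/9`, `V(3,1) = V(3,2) = 0`):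

* `nbGram_zero_two : G_{13} = ⅔(log 2π − γ) − (log 3)/3 + π√3/54` (`= 0.5750034694621839543…`, lineage A6 to 60 digits);
* `nbGram_one_two  : G_{23} = (5/12)(log 2π − γ) + (log 2 − log 3)/12 − π√3/108` (`= 0.4411035092794021763…`).

(`G_{11}, G_{22} = (log 2π − γ)/k` and `G_{12} = ¾(log 2π − γ) − ¼ log 2` are g3's `nbGram_diag`, `nbGram_zero_one`.)
RH-FREE [rh-li-eng-3 g4]: special values of a classical formula; nothing here bears on the truth of RH.
-/

noncomputable section

-- D-0017: `Summit.<S>.<S>.…` is the designed namespace of a single-problem summit.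
set_option linter.dupNamespace false

namespace Summit.RiemannHypothesis.RiemannHypothesis.Theorems.NbTheory

open Literature.NumberTheory.LFunctions

namespace GramThree

/-- `cot(π/3) = √3/3`. -/
lemma cot_pi_div_three : Real.cot (Real.pi / 3) = Real.sqrt 3 / 3 := by
  have hs : Real.sqrt 3 * Real.sqrt 3 = 3 := Real.mul_self_sqrt (by norm_num)
  have hs0 : Real.sqrt 3 ≠ 0 := by positivity
  rw [Real.cot_eq_cos_div_sin, Real.cos_pi_div_three, Real.sin_pi_div_three]
  field_simp
  linarith [hs]

/-- `cot(2π/3) = −√3/3`. -/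
lemma cot_two_pi_div_three : Real.cot (2 * Real.pi / 3) = -(Real.sqrt 3 / 3) := by
  have hs : Real.sqrt 3 * Real.sqrt 3 = 3 := Real.mul_self_sqrt (by norm_num)
  have hs0 : Real.sqrt 3 ≠ 0 := by positivity
  rw [show 2 * Real.pi / 3 = Real.pi - Real.pi / 3 by ring, Real.cot_eq_cos_div_sin, Real.cos_pi_sub, Real.sin_pi_sub,
    Real.cos_pi_div_three, Real.sin_pi_div_three]
  field_simp
  linarith [hs]

/-- `V(1,3) = {1/3}cot(π/3) + {2/3}cot(2π/3) = −√3/9`. -/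
lemma vasyuninCotSum_one_three : vasyuninCotSum 1 3 = -(Real.sqrt 3 / 9) := by
  rw [vasyuninCotSum, show Finset.Ico 1 3 = {1, 2} by rfl, Finset.sum_pair (by norm_num)]
  push_cast
  rw [show (1 : ℝ) * 1 / 3 = 1 / 3 by norm_num, show (2 : ℝ) * 1 / 3 = 2 / 3 by norm_num,
    show (1 : ℝ) * Real.pi / 3 = Real.pi / 3 by ring, show (2 : ℝ) * Real.pi / 3 = 2 * Real.pi / 3 by ring,
    Int.fract_eq_self.mpr ⟨by norm_num, by norm_num⟩, Int.fract_eq_self.mpr ⟨by norm_num, by norm_num⟩,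
    cot_pi_div_three, cot_two_pi_div_three]
  ring

/-- `V(2,3) = {2/3}cot(π/3) + {4/3}cot(2π/3) = √3/9`. -/
lemma vasyuninCotSum_two_three : vasyuninCotSum 2 3 = Real.sqrt 3 / 9 := by
  rw [vasyuninCotSum, show Finset.Ico 1 3 = {1, 2} by rfl, Finset.sum_pair (by norm_num)]
  push_cast
  have h43 : Int.fract ((2 : ℝ) * 2 / 3) = 1 / 3 := by
    rw [Int.fract_eq_iff]
    exact ⟨by norm_num, by norm_num, ⟨1, by norm_num⟩⟩
  rw [show (1 : ℝ) * 2 / 3 = 2 / 3 by norm_num, show (1 : ℝ) * Real.pi / 3 = Real.pi / 3 by ring,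
    show (2 : ℝ) * Real.pi / 3 = 2 * Real.pi / 3 by ring, Int.fract_eq_self.mpr ⟨by norm_num, by norm_num⟩, h43,
    cot_pi_div_three, cot_two_pi_div_three]
  ring

/-- `V(3,1) = 0` (empty sum). -/
lemma vasyuninCotSum_three_one : vasyuninCotSum 3 1 = 0 := by
  rw [vasyuninCotSum, show Finset.Ico 1 1 = ∅ by rfl, Finset.sum_empty]

/-- `V(3,2) = {3/2}cot(π/2) = 0`. -/
lemma vasyuninCotSum_three_two : vasyuninCotSum 3 2 = 0 := by
  rw [vasyuninCotSum, show Finset.Ico 1 2 = {1} by rfl, Finset.sum_singleton]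
  push_cast
  rw [show (1 : ℝ) * Real.pi / 2 = Real.pi / 2 by ring, Real.cot_eq_cos_div_sin, Real.cos_pi_div_two]
  simp

end GramThree

open GramThree

/-- **`G_{13} = ⟨ρ_1, ρ_3⟩ = ⅔(log 2π − γ) − (log 3)/3 + π√3/54`** (RH-FREE; `= 0.57500346946218395431…`). -/
theorem nbGram_zero_two :
    nbGram 0 2 = 2 / 3 * (Real.log (2 * Real.pi) - Real.eulerMascheroniConstant) - Real.log 3 / 3
      + Real.pi * Real.sqrt 3 / 54 := by
  rw [nbGram_eq_vasyunin 0 2]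
  have hg : Nat.gcd (0 + 1) (2 + 1) = 1 := by decide
  simp only [hg, Nat.div_one, zero_add]
  norm_num
  rw [vasyuninCotSum_one_three, vasyuninCotSum_three_one, Real.log_div one_ne_zero three_ne_zero, Real.log_one]
  ring

/-- **`G_{23} = ⟨ρ_2, ρ_3⟩ = (5/12)(log 2π − γ) + (log 2 − log 3)/12 − π√3/108`** (RH-FREE; `= 0.44110350927940217632…`). -/
theorem nbGram_one_two :
    nbGram 1 2 = 5 / 12 * (Real.log (2 * Real.pi) - Real.eulerMascheroniConstant) + (Real.log 2 - Real.log 3) / 12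
      - Real.pi * Real.sqrt 3 / 108 := by
  rw [nbGram_eq_vasyunin 1 2]
  have hg : Nat.gcd (1 + 1) (2 + 1) = 1 := by decide
  simp only [hg, Nat.div_one]
  norm_num
  rw [vasyuninCotSum_two_three, vasyuninCotSum_three_two, Real.log_div two_ne_zero three_ne_zero]
  ring

end Summit.RiemannHypothesis.RiemannHypothesis.Theorems.NbTheory

end
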